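import Summits.BirchSwinnertonDyer.BirchSwinnertonDyer.Theorems.PrintCf2SplitBadTwoRestrictedSelmerFiniteOfSha
import Summits.BirchSwinnertonDyer.BirchSwinnertonDyer.Theorems.PrintCf2SplitBadTwoCMScalarAtVOfEtale
import Summits.BirchSwinnertonDyer.BirchSwinnertonDyer.Theorems.PrintCf2SplitBadTwoKummerBranchInputs
import Summits.BirchSwinnertonDyer.BirchSwinnertonDyer.Theorems.PrintCf2SplitBadTwoCMShaDescentSquare
import HarnessLib

/-!
# Crux `PrintCf2.SplitBadTwoRankOneOfFacts` (stmt-BirchSwinnertonDyer-20368), road α v11, (BF) «`Ш` finite ⟹ `𝔖_{v̄}(K, W*)` finite»,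
# part 4: the local clause (MW-v̄) FROM THE ÉTALE BRICK (ET-v̄), and (BF) with `Finite W.sha` (LEAD RULING (R-ET), 2026-08-29T00:38:07Z)

Cell `bsd-print-cf2`, EXTRA WIDTH seat `bsd-line-cf2-p1-w4` g10 (prover-bsd-line-cf2-p1-w4-g10-0); `--supports stmt-BirchSwinnertonDyer-20368`
(helper, Theses-free). HONEST FRAMING: nothing here closes the crux or a registered stub; BSD is not proved by any of this; no summit
`Statement.lean` is touched; no `sorry`, no new axiom, no Literature fact, no definition.

Notation: `E := W.baseChange K` for a member `W` of the class (`C • W = cm7^{(d)}`), `K` imaginary quadratic with `2 = v·v̄`, `π ∈ End_K(E)` with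
`π² = π − 2`, `r ∈ ℤ₂` with `r² = r − 2`, `W* := E[𝔮_r^∞] = endEigenPrimaryTorsion 2 π r`, `W*′ := E[𝔮_{1−r}^∞]`, `𝔖 := 𝔖_{v̄}(K, W*) =
restrictedSelmerBase W* 2 v̄`, `κ_n` the level-`2^n` Kummer map, `κ_∞` the `2^∞` Kummer map, `P_K` the base change of the `ℚ`-generator `P`.

## What is proved

Part 3 (`finite_restrictedSelmerBase_of_finite_sha_of_frame`, this seat) proved `Finite Ш(E/K)[2^∞] ∧ (MW-v̄) ⟹ Finite 𝔖` on every S3c frame, with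
(MW-v̄) := «the `W*`-component of the Mordell–Weil Kummer line is NOT contained in `ker res_{D_v̄}`», and showed (MW-v̄) is necessary. Here:

* `not_comap_kummer_le_ker_of_etale` — **(ET-v̄) ⟹ (MW-v̄)**, hfin-free and pinning-free. (ET-v̄) is the twin at `v̄` of -w3 g10's (ET-v)
  (`CMPrimes.cmScalar_localPoints_of_frame_of_etale`'s hypothesis `hET`): «for every equivariant projector `e′` onto `W*′` killing `W*`, every
  `K`-point `Q` and every `n`, `2 • res_{D_v̄}(e′_* res_⊤ κ_n(Q)) = 0`» (at `v̄` the kernel-of-reduction line of the good twist is `W*`, so the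
  `W*′`-component of a Kummer class is unramified up to the quadratic character, hence `2`-torsion on `D_v̄`). PROOF: were the `W*`-line
  contained in `ker res_{D_v̄}`, the `W*`-component `e_* res_⊤ κ_n(P_K)` (a Kummer class by the stability `resSubgroup_kummer_stable`) would die
  on `D_v̄` for every `n`; by -w3 g10's scalar dichotomy at `v̄` (`cmScalar_dichotomy_localPoints`, places swapped) `π` acts on `E(K_v̄)/tors`
  as `c ∈ {r, 1 − r}`; if `c = r`, `isOfFinAddOrder_of_cmScalar_eq_root_of_two_nsmul` (at `v̄`, root `r`, projector `e`) makes `P_K` torsion;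
  if `c = 1 − r`, the same lemma at root `1 − r` with the projector `e′` and (ET-v̄) makes `P_K` torsion. Either way `P` is torsion — absurd.
* `finite_sha_two_primary_baseChange_of_finite_sha` — `Finite Ш(W/ℚ) ⟹ Finite Ш(E/K)[2^∞]` for a member (`#Ш(E/K)[2^∞] = (#Ш(W/ℚ)[2^∞])²`,
  -w8's `natCard_sha_two_primary_baseChange_eq_sq`, `Nat.card` of a nonempty finite group is positive).
* `finite_restrictedSelmerBase_of_finite_sha_two_primary_of_etale` — (BF) with the binders of part 3 and (MW-v̄) REPLACED by (ET-v̄).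
* `finite_restrictedSelmerBase_of_finite_sha_of_etale` — **(FIN) of the v11 cut** (cf2c-w3 g0's `hFIN` binder order VERBATIM: member block with
  `Finite W.sha`, then `K, v, v̄`, then `π hπ r hr hpin`, then `P c₀ ℓ hP hgen hc₀ hker hlog`) with ONE extra trailing hypothesis, (ET-v̄).
  Once -w3 g10's `hET_holds` (LEAD RULING (R-ET)) is in the tree at the conjugate place, `hFIN` is this theorem applied to it.

[cite: Agboola2007, §6 Props. 6.10–6.12, Thm. 6.12 (arXiv p0014–p0015)] [cite: GreenbergLNM1716, §2 Props. 2.1–2.2, p. 63]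
[cite: Rubin1999, §3 Lemma 3.6 (ii), Cor. 3.17] [cite: GrossLMS1991, §5 (5.1)] [cite: SilvermanAEC2009, Prop. VII.6.3]
-/

noncomputable section

set_option linter.dupNamespace false

open scoped Classical
open scoped TensorProduct

open CategoryTheory Function Field NumberField IsDedekindDomain WeierstrassCurve
open Literature.NumberTheory.EllipticCurves Literature.NumberTheory.EllipticCurves.GreenbergSelmer
open Literature.NumberTheory.EllipticCurves.Agboola2007
open Literature.NumberTheory.EllipticCurves.ResKernel
open Literature.NumberTheory.GaloisRepresentations
open Literature.NumberTheory.GaloisCohomology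
open scoped ContRepresentation
open Summit.BirchSwinnertonDyer.Rank1Residual.X11b
open Summit.BirchSwinnertonDyer.BirchSwinnertonDyer.Theorems.PrintCf2.RestrictedSelmerPair
open Summit.BirchSwinnertonDyer.BirchSwinnertonDyer.Theorems.PrintCf2.AdditiveAtSeven
open Summit.BirchSwinnertonDyer.BirchSwinnertonDyer.Theorems.GoldfeldGoodTwists
open Summit.BirchSwinnertonDyer.BirchSwinnertonDyer.Theorems.PrintCf2.CMPrimes

namespace Summit.BirchSwinnertonDyer.BirchSwinnertonDyer.Theorems.PrintCf2.RelaxationLift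

variable {K : Type} [Field K] [NumberField K]

/-! ## §1. (ET-v̄) ⟹ (MW-v̄) -/

/-- **(ET-v̄) ⟹ (MW-v̄)** (hfin-free, pinning-free). On the frame (`C • W = cm7^{(d)}`, `K` imaginary quadratic with `2 = v·v̄`, `π² = π − 2`,
`r² = r − 2`, `P ∈ W(ℚ)` of infinite order): IF for every equivariant projector `e′` onto `W*′ = E[𝔮_{1−r}^∞]` killing `W* = E[𝔮_r^∞]`, every
`K`-point `Q` and every `n` the class `res_{D_v̄}(e′_* res_⊤ κ_n(Q))` is `2`-torsion, THEN the `W*`-component of the Mordell–Weil Kummer line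
`{y ∈ H¹(K, W*) : ι_* y ∈ res_⊤ κ_∞(E(K) ⊗ ℚ₂/ℤ₂)}` is NOT contained in `ker res_{D_v̄}`. Proof: scalar dichotomy at `v̄` (`c ∈ {r, 1 − r}`) and
-w3 g10's `isOfFinAddOrder_of_cmScalar_eq_root_of_two_nsmul` at `v̄` for the root `c`, fed by the containment (branch `c = r`, stability
`resSubgroup_kummer_stable`) or by (ET-v̄) (branch `c = 1 − r`): `P_K` would be torsion.
[cite: GreenbergLNM1716, §2 Props. 2.1–2.2] [cite: Rubin1999, §3 Lemma 3.6 (ii)] [cite: Agboola2007, §6 Prop. 6.11 (arXiv p0014)] -/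
theorem not_comap_kummer_le_ker_of_etale {d : ℤ} (hd0 : d ≠ 0) (W : WeierstrassCurve ℚ) [W.IsElliptic]
    (C : VariableChange ℚ) (hC : C • W = cm7.quadraticTwist (d : ℚ)) (hK : IsImaginaryQuadratic K)
    {v vbar : HeightOneSpectrum (𝓞 K)} (hv : ((2 : ℕ) : 𝓞 K) ∈ v.asIdeal) (hvbar : ((2 : ℕ) : 𝓞 K) ∈ vbar.asIdeal) (hne : vbar ≠ v)
    (π : (W.baseChange K).endRing) (hrel : (π : AddMonoid.End (W.baseChange K).geomPoints) * π = π - 2) {r : ℤ_[2]} (hr : r * r = r - 2)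
    {P : W.toAffine.Point} (hP : ¬ IsOfFinAddOrder P)
    (hET : ∀ (e' : (W.baseChange K).geomPrimaryTorsion 2 →+ ↥((W.baseChange K).endEigenPrimaryTorsion 2 π (1 - r)))
        (_ : ∀ x : ↥((W.baseChange K).endEigenPrimaryTorsion 2 π (1 - r)), e' x = x)
        (_ : ∀ x ∈ (W.baseChange K).endEigenPrimaryTorsion 2 π r, e' x = 0)
        (he' : ∀ (σ : absoluteGaloisGroup K) (x : (W.baseChange K).geomPrimaryTorsion 2), e' (σ • x) = σ • e' x)
        (Q : (W.baseChange K).toAffine.Point) (n : ℕ),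
        2 • resOfLe ↥((W.baseChange K).endEigenPrimaryTorsion 2 π (1 - r)) (inf_le_left : ⊤ ⊓ decomp vbar ≤ ⊤)
          (resH1Hom (ContinuousMonoidHom.id (⊤ : Subgroup (absoluteGaloisGroup K))) e' (fun σ x ↦ he' σ x)
            (resSubgroup ⊤ ((W.baseChange K).geomPrimaryTorsion 2)
              ((W.baseChange K).kummerMapLevel 2 (W.baseChange K).zsmul_geomPoints_surjective_holds n Q))) = 0) :
    ¬ (((((W.baseChange K).kummerMapPInfty 2 (W.baseChange K).zsmul_geomPoints_surjective_holds).range).map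
          (resSubgroup ⊤ ((W.baseChange K).geomPrimaryTorsion 2))).comap
            (resH1Hom (ContinuousMonoidHom.id _) ((W.baseChange K).endEigenPrimaryTorsion 2 π r).subtype (fun _ _ ↦ rfl)) ≤
        (resOfLe ↥((W.baseChange K).endEigenPrimaryTorsion 2 π r) (@inf_le_left _ _ (⊤ : Subgroup (absoluteGaloisGroup K)) (decomp vbar))).ker) := by
  intro hle
  haveI : Fact (Nat.Prime 2) := ⟨Nat.prime_two⟩
  haveI : (W.baseChange K).IsElliptic := by rw [baseChange]; infer_instance
  -- the CM isogeny realising `π`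
  have hπg : (π : AddMonoid.End (W.baseChange K).geomPoints) ∈ (W.baseChange K).geomEndRing := (W.baseChange K).endRing_le_geomEndRing π.2
  have hπG : ∀ (g : absoluteGaloisGroup K) (Q : (W.baseChange K).geomPoints),
      (π : AddMonoid.End (W.baseChange K).geomPoints) (g • Q) = g • (π : AddMonoid.End (W.baseChange K).geomPoints) Q :=
    ((W.baseChange K).mem_equivariantSubring_iff _).mp (Subring.mem_inf.mp π.2).2
  obtain ⟨φ, hφ, hφ2⟩ := exists_isogeny_apply_eq_cmEndo (W.baseChange K) hπg hπG hrel
  obtain ⟨hinf, hsup⟩ := endEigenPrimaryTorsion_compl_of_frame hd0 W C hC K π hrel hr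
  have hunit : IsUnit (r - (1 - r)) := (two_dvd_or_two_dvd_one_sub_of_root hr).2
  set PK : (W.baseChange K).toAffine.Point := Affine.Point.map (W' := W.toAffine) (Algebra.ofId ℚ K) P with hPKdef
  have hPK : ¬ IsOfFinAddOrder PK := not_isOfFinAddOrder_map_ofId W hP
  -- the scalar dichotomy at `v̄` (places swapped)
  obtain ⟨c, hc, H⟩ := cmScalar_dichotomy_localPoints hK.1 hvbar hv hne.symm (W.baseChange K) φ hφ2 hr
  rcases hc with hc | hc
  · -- branch `c = r`: the `W*`-components of the Kummer classes of `P_K` die on `D_v̄` by the containment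
    rw [hc] at H
    obtain ⟨e, he₁, he0, -, he⟩ := exists_eigenProjector (W.baseChange K) 2 π r (1 - r) hinf hsup
    obtain ⟨e', -, -, hsum⟩ := SelmerLocImage.exists_compl_projector (W.baseChange K) 2 π r (1 - r) e he₁ he0 he hsup
    refine hPK (isOfFinAddOrder_of_cmScalar_eq_root_of_two_nsmul hK.1 hvbar hv hne.symm (W.baseChange K) π hr hinf hsup φ hφ
      e he₁ he0 he PK (fun n ↦ ?_) H)
    have hmem : resH1Hom (ContinuousMonoidHom.id (⊤ : Subgroup (absoluteGaloisGroup K))) e (fun σ x ↦ he σ x)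
        (resSubgroup ⊤ ((W.baseChange K).geomPrimaryTorsion 2)
          ((W.baseChange K).kummerMapLevel 2 (W.baseChange K).zsmul_geomPoints_surjective_holds n PK)) ∈
        ((((W.baseChange K).kummerMapPInfty 2 (W.baseChange K).zsmul_geomPoints_surjective_holds).range).map
          (resSubgroup ⊤ ((W.baseChange K).geomPrimaryTorsion 2))).comap
            (resH1Hom (ContinuousMonoidHom.id _) ((W.baseChange K).endEigenPrimaryTorsion 2 π r).subtype (fun _ _ ↦ rfl)) := by
      rw [AddSubgroup.mem_comap]
      refine resSubgroup_kummer_stable (W.baseChange K) 2 π r (1 - r) hunit e e' he hsum _ ?_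
      exact ⟨_, ⟨PK ⊗ₜ prufGen 2 n, rfl⟩, by rw [kummerMapPInfty_tmul_prufGen]⟩
    have h0 := hle hmem
    rw [AddMonoidHom.mem_ker] at h0
    rw [h0, smul_zero]
  · -- branch `c = 1 − r`: the `W*′`-components are `2`-torsion on `D_v̄` by (ET-v̄)
    rw [hc] at H
    have hr' : (1 - r) * (1 - r) = (1 - r) - 2 := by linear_combination hr
    obtain ⟨hinf', hsup'⟩ := endEigenPrimaryTorsion_compl_of_frame hd0 W C hC K π hrel hr'
    obtain ⟨e', he'₁, he'0, -, he'⟩ := exists_eigenProjector (W.baseChange K) 2 π (1 - r) (1 - (1 - r)) hinf' hsup'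
    exact hPK (isOfFinAddOrder_of_cmScalar_eq_root_of_two_nsmul hK.1 hvbar hv hne.symm (W.baseChange K) π hr' hinf' hsup' φ hφ
      e' he'₁ he'0 he' PK (fun n ↦ hET e' he'₁ (fun x hx ↦ he'0 x (by rwa [sub_sub_cancel])) he' PK n) H)

/-! ## §2. `Finite Ш(W/ℚ) ⟹ Finite Ш(E/K)[2^∞]` for a member -/

/-- **`Finite Ш(W/ℚ) ⟹ Finite Ш(W_K/K)[2^∞]`** for a member of the class over an imaginary quadratic `K` carrying a `K`-rational CM endomorphism
`π` (`π² = π − 2`, so `√−7 ∈ K`): `#Ш(W_K)[2^∞] = (#Ш(W/ℚ)[2^∞])²` (-w8's `natCard_sha_two_primary_baseChange_eq_sq`, `Nat.card` on both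
sides) and the right side is positive. [cite: GrossLMS1991, §5 (5.1)] [cite: Agboola2007, §6 Props. 6.10–6.11] -/
theorem finite_sha_two_primary_baseChange_of_finite_sha {d : ℤ} (hd0 : d ≠ 0) (W : WeierstrassCurve ℚ) [W.IsElliptic]
    (C : VariableChange ℚ) (hC : C • W = cm7.quadraticTwist (d : ℚ)) (hK : IsImaginaryQuadratic K)
    (π : (W.baseChange K).endRing) (hrel : (π : AddMonoid.End (W.baseChange K).geomPoints) * π = π - 2) [Finite W.sha] :
    Finite (AddCommGroup.primaryComponent (W.baseChange K).sha 2) := by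
  obtain ⟨θ, hθ⟩ := exists_sq_eq_neg_seven_of_frame_cmEndo hd0 W C hC π hrel
  have hne0 : Nat.card (AddCommGroup.primaryComponent (W.baseChange K).sha 2) ≠ 0 := by
    rw [natCard_sha_two_primary_baseChange_eq_sq W (j_eq_of_smul_eq_cm7Twist hd0 W C hC) hK hθ]
    exact pow_ne_zero _ Nat.card_pos.ne'
  exact Nat.finite_of_card_ne_zero hne0

/-! ## §3. (BF) from (ET-v̄) -/

/-- **(BF) from (ET-v̄), `Ш(W_K)[2^∞]` currency**: on every S3c frame (binders of part 3's `finite_restrictedSelmerBase_of_finite_sha_of_frame`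
VERBATIM, the displayed clause (MW-v̄) REPLACED by the étale brick (ET-v̄) «`2 • res_{D_v̄}(e′_* res_⊤ κ_n(Q)) = 0` for every equivariant
projector `e′` onto `W*′` killing `W*`, every `K`-point `Q`, every `n`»), `Finite Ш(W_K/K)[2^∞] ⟹ Finite 𝔖_{v̄}(K, W*)`.
[cite: Agboola2007, §6 Props. 6.10–6.12, Thm. 6.12 (arXiv p0014–p0015)] [cite: GreenbergLNM1716, §2 Props. 2.1–2.2, §5 proof of Prop. 5.8] -/
theorem finite_restrictedSelmerBase_of_finite_sha_two_primary_of_etale :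
    ∀ (d : ℤ), d ≠ 0 → Squarefree d → d % 4 ≠ 1 →
      ∀ (W : WeierstrassCurve ℚ) [W.IsElliptic] [W.IsGloballyMinimal] (C : WeierstrassCurve.VariableChange ℚ),
        C • W = cm7.quadraticTwist (d : ℚ) → W.analyticRank = 1 →
      ∀ (K : Type) [Field K] [NumberField K], IsImaginaryQuadratic K →
      ∀ (v vbar : HeightOneSpectrum (𝓞 K)),
        ((2 : ℕ) : 𝓞 K) ∈ v.asIdeal → ((2 : ℕ) : 𝓞 K) ∈ vbar.asIdeal → vbar ≠ v →
      ∀ (π : (W.baseChange K).endRing), (π : AddMonoid.End (W.baseChange K).geomPoints) * π = π - 2 →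
      ∀ (r : ℤ_[2]), r * r = r - 2 →
        (∀ τ ∈ GreenbergSelmer.inertia v, ∀ x : ↥((W.baseChange K).endEigenPrimaryTorsion 2 π r), τ • x = x ∨ τ • x = -x) →
      ∀ (P : W.toAffine.Point) (c₀ : ℕ) (ℓ : ℤ),
        ¬ IsOfFinAddOrder P →
        (∀ R : W.toAffine.Point, ∃ (k : ℤ) (T : W.toAffine.Point), IsOfFinAddOrder T ∧ R = k • P + T) →
        c₀ ≠ 0 → (W.baseChange ℚ_[2]).IsInReductionKernel (c₀ • W.toPadicPoint 2 P) →
        ‖(W.baseChange ℚ_[2]).padicLogPoint (c₀ • W.toPadicPoint 2 P) / (c₀ : ℚ_[2])‖ = (2 : ℝ) ^ (-ℓ) →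
      Finite (AddCommGroup.primaryComponent (W.baseChange K).sha 2) →
      (∀ (e' : (W.baseChange K).geomPrimaryTorsion 2 →+ ↥((W.baseChange K).endEigenPrimaryTorsion 2 π (1 - r)))
        (_ : ∀ x : ↥((W.baseChange K).endEigenPrimaryTorsion 2 π (1 - r)), e' x = x)
        (_ : ∀ x ∈ (W.baseChange K).endEigenPrimaryTorsion 2 π r, e' x = 0)
        (he' : ∀ (σ : absoluteGaloisGroup K) (x : (W.baseChange K).geomPrimaryTorsion 2), e' (σ • x) = σ • e' x)
        (Q : (W.baseChange K).toAffine.Point) (n : ℕ),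
        2 • resOfLe ↥((W.baseChange K).endEigenPrimaryTorsion 2 π (1 - r)) (inf_le_left : ⊤ ⊓ decomp vbar ≤ ⊤)
          (resH1Hom (ContinuousMonoidHom.id (⊤ : Subgroup (absoluteGaloisGroup K))) e' (fun σ x ↦ he' σ x)
            (resSubgroup ⊤ ((W.baseChange K).geomPrimaryTorsion 2)
              ((W.baseChange K).kummerMapLevel 2 (W.baseChange K).zsmul_geomPoints_surjective_holds n Q))) = 0) →
      Finite (restrictedSelmerBase ↥((W.baseChange K).endEigenPrimaryTorsion 2 π r) 2 vbar) := by
  intro d hd0 hsq hd4 W _ _ C hC hrank K _ _ hK v vbar hv hvbar hne π hrel r hr hpin P c₀ ℓ hP hgen hc₀ hker hlog hsha hET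
  exact finite_restrictedSelmerBase_of_finite_sha_of_frame d hd0 hsq hd4 W C hC hrank K hK v vbar hv hvbar hne π hrel r hr hpin P c₀ ℓ
    hP hgen hc₀ hker hlog hsha (not_comap_kummer_le_ker_of_etale hd0 W C hC hK hv hvbar hne π hrel hr hP hET)

/-- **(FIN) of the v11 cut from (ET-v̄)**: the binders of cf2c-w3 g0's `hFIN` (`restrictedMainConj_two_v11_of_finiteOfSha_of_twistPush`)
VERBATIM — member block with `Finite W.sha`, then `K, v, v̄`, then `π hπ r hr hpin`, then `P c₀ ℓ hP hgen hc₀ hker hlog` — followed by ONE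
trailing hypothesis, the étale brick (ET-v̄), conclude `Finite 𝔖_{v̄}(K, W*)`. So `hFIN := fun d … hlog ↦ this d … hlog <(ET-v̄) on that frame>`.
[cite: Agboola2007, §6 Thm. 6.12 (arXiv p0015)] [cite: GrossLMS1991, §5 (5.1)] [cite: GreenbergLNM1716, §2 Props. 2.1–2.2] -/
theorem finite_restrictedSelmerBase_of_finite_sha_of_etale :
    ∀ (d : ℤ), d ≠ 0 → Squarefree d → d % 4 ≠ 1 →
      ∀ (W : WeierstrassCurve ℚ) [W.IsElliptic] [W.IsGloballyMinimal] (C : VariableChange ℚ),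
        C • W = cm7.quadraticTwist (d : ℚ) → W.analyticRank = 1 →
        Finite W.sha →
      ∀ (K : Type) [Field K] [NumberField K], IsImaginaryQuadratic K →
      ∀ (v vbar : HeightOneSpectrum (𝓞 K)),
        ((2 : ℕ) : 𝓞 K) ∈ v.asIdeal → ((2 : ℕ) : 𝓞 K) ∈ vbar.asIdeal → vbar ≠ v →
      ∀ (π : (W.baseChange K).endRing), (π : AddMonoid.End (W.baseChange K).geomPoints) * π = π - 2 →
      ∀ (r : ℤ_[2]), r * r = r - 2 →
        (∀ τ ∈ GreenbergSelmer.inertia v, ∀ x : ↥((W.baseChange K).endEigenPrimaryTorsion 2 π r), τ • x = x ∨ τ • x = -x) →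
      ∀ (P : W.toAffine.Point) (c₀ : ℕ) (ℓ : ℤ),
        ¬ IsOfFinAddOrder P →
        (∀ R : W.toAffine.Point, ∃ (k : ℤ) (T : W.toAffine.Point), IsOfFinAddOrder T ∧ R = k • P + T) →
        c₀ ≠ 0 → (W.baseChange ℚ_[2]).IsInReductionKernel (c₀ • W.toPadicPoint 2 P) →
        ‖(W.baseChange ℚ_[2]).padicLogPoint (c₀ • W.toPadicPoint 2 P) / (c₀ : ℚ_[2])‖ = (2 : ℝ) ^ (-ℓ) →
      (∀ (e' : (W.baseChange K).geomPrimaryTorsion 2 →+ ↥((W.baseChange K).endEigenPrimaryTorsion 2 π (1 - r)))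
        (_ : ∀ x : ↥((W.baseChange K).endEigenPrimaryTorsion 2 π (1 - r)), e' x = x)
        (_ : ∀ x ∈ (W.baseChange K).endEigenPrimaryTorsion 2 π r, e' x = 0)
        (he' : ∀ (σ : absoluteGaloisGroup K) (x : (W.baseChange K).geomPrimaryTorsion 2), e' (σ • x) = σ • e' x)
        (Q : (W.baseChange K).toAffine.Point) (n : ℕ),
        2 • resOfLe ↥((W.baseChange K).endEigenPrimaryTorsion 2 π (1 - r)) (inf_le_left : ⊤ ⊓ decomp vbar ≤ ⊤)
          (resH1Hom (ContinuousMonoidHom.id (⊤ : Subgroup (absoluteGaloisGroup K))) e' (fun σ x ↦ he' σ x)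
            (resSubgroup ⊤ ((W.baseChange K).geomPrimaryTorsion 2)
              ((W.baseChange K).kummerMapLevel 2 (W.baseChange K).zsmul_geomPoints_surjective_holds n Q))) = 0) →
      Finite (restrictedSelmerBase ↥((W.baseChange K).endEigenPrimaryTorsion 2 π r) 2 vbar) := by
  intro d hd0 hsq hd4 W _ _ C hC hrank hsha K _ _ hK v vbar hv hvbar hne π hrel r hr hpin P c₀ ℓ hP hgen hc₀ hker hlog hET
  haveI := hsha
  exact finite_restrictedSelmerBase_of_finite_sha_two_primary_of_etale d hd0 hsq hd4 W C hC hrank K hK v vbar hv hvbar hne π hrel r hr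
    hpin P c₀ ℓ hP hgen hc₀ hker hlog (finite_sha_two_primary_baseChange_of_finite_sha hd0 W C hC hK π hrel) hET

end Summit.BirchSwinnertonDyer.BirchSwinnertonDyer.Theorems.PrintCf2.RelaxationLift

end
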